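import Literature.AnabelianGeometry.AbsoluteAnabelian.GaloisCyclotomeMLFHolds
import Literature.AnabelianGeometry.AbsoluteAnabelian.MLFGaloisModelPairs
import HarnessLib

/-!
# [AbsTopIII] Cor. 1.10 (i)(a) / Rmk. 3.2.1: the group-theoretic cyclotome `μ_Ẑ(G_k)` IS `Ẑ(1) = Λ(k̄ˣ)`

S. Mochizuki, *Topics in absolute anabelian geometry III*, Cor. 1.10 (i)(a) p. 41–42 («`μ_Ẑ(G_k) :=
Hom(ℚ/ℤ, μ_{ℚ/ℤ}(G_k))` … [Thus, the underlying module of `μ_{ℚ/ℤ}(G_k)` …]», built from [AbsAnab] Prop.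
1.2.1 (vi) «`μ_{ℚ/ℤ}(K̄_1) ⥲ μ_{ℚ/ℤ}(K̄_2)` … Galois-equivariant») and Rmk. 3.2.1 p. 73 («a functorial
algorithm for constructing the natural isomorphism `μ_Ẑ(M_TM) ⥲ μ_Ẑ(G)`»).  JUNCTION FILE between
three REAL objects of the tree, all previously unconnected at the `μ_Ẑ`-level:

* abc-iut-L4-t1's group-theoretic cyclotome `muZhat G_k = Λ(μ_{ℚ/ℤ}(G_k))` (`GaloisCyclotome.lean`);
* the field-theoretic `Ẑ(1) := Λ(k̄ˣ) = lim_n μ_n(k̄)` (`EtaleTheta.cyclotome (AlgebraicClosure k)ˣ`),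
  the target of abc-iut-L4-t2's model isomorphism `MLFClosure.cyclotomeUnitsEquiv : μ_Ẑ(𝒪_k̄^⊳) ⥲ Ẑ(1)`
  (Rmk. 3.2.1 for the model, `MLFGaloisModelPairs.lean`);
* the now PROVED comparison `μ_{ℚ/ℤ}(G_k) ≅ (k̄ˣ)_tors` (`TorsionReciprocityData.equiv`, abc-iut-L4-t1;
  data constructed for every non-archimedean local field of characteristic `0` by abc-iut-L6-t11,
  `nonempty_torsionReciprocityData`, `mlfGaloisCyclotomeIsRootsOfUnity_holds`).

Contents (constructions + proofs; no new notion):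
* `EtaleTheta.cyclotome.torsionEquiv : Λ(A_tors) ≃* Λ(A)` — general;
* `TorsionReciprocityData.muZhatEquiv D : μ_Ẑ(G_k) ≃* Λ(k̄ˣ)` (apply `Λ(−)` to `D.equiv`, then
  `torsionEquiv`), `G_k`-equivariant (`muZhatEquiv_smul_coe`);
* `exists_muZhat_mulEquiv_cyclotome_units` — «`μ_Ẑ(G_k) ≅ Ẑ(1)` equivariantly», UNCONDITIONAL for every
  non-archimedean local field of characteristic `0` (and `_of_isMLF` for the `IsMLF` binder);
* `exists_cyclotome_nonzeroIntegers_mulEquiv_muZhat` — Rmk. 3.2.1 «`μ_Ẑ(M_TM) ⥲ μ_Ẑ(G)`» for the MODEL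
  pair `(G_k ↷ 𝒪_k̄^⊳)` with the GROUP-THEORETIC `μ_Ẑ(G_k)` as target (plan row P32.i.L08 of
  `plan/L4/SUBDAG-AbsTopIII-Prop32.md`, abc-iut-w4-d045).

HONEST FRAMING: local class field theory as proved in the tree; the identification is canonical GIVEN
the reciprocity data `D` (the existence statements quantify it away); nothing here bears on [IUTchIII]
Cor. 3.12; no side taken.
-/

noncomputable section

namespace Literature.AnabelianGeometry.EtaleTheta.cyclotome

open Function

universe u v

variable {A : Type u} [CommGroup A] {B : Type v} [CommGroup B]

/-- Functoriality of `Λ(−)` on isomorphisms, `A ≃* B ⟹ Λ(A) ≃* Λ(B)` componentwise — a LOCAL copy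
(the tree's public `cyclotome.mapEquiv` sits in an [IUTchII] file, `IUT/HodgeArakelov/GaloisPairRigiditySubdag`,
which this [AbsTopIII]-level file must not import). [cite: LANA2026Report, §6.1 p.32] -/
private def isoMap (e : A ≃* B) : cyclotome A ≃* cyclotome B where
  toFun := map e.toMonoidHom
  invFun := map e.symm.toMonoidHom
  left_inv ζ := Subtype.ext (funext fun n => by simp [map])
  right_inv ξ := Subtype.ext (funext fun n => by simp [map])
  map_mul' := map_mul _

/-- Every component of an element of `Λ(A)` is torsion. [cite: LANA2026Report, §6.1 p.31] -/
theorem apply_mem_torsion (ζ : cyclotome A) (n : ℕ+) : (ζ : ℕ+ → A) n ∈ CommGroup.torsion A :=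
  (CommGroup.mem_torsion _).2 (isOfFinOrder_iff_pow_eq_one.2 ⟨n, n.pos, pow_eq_one ζ n⟩)

/-- **`Λ(A_tors) ≃* Λ(A)`**: the cyclotome only sees the torsion subgroup (components of compatible
families are torsion). [cite: LANA2026Report, §6.1 p.31] -/
def torsionEquiv : cyclotome (CommGroup.torsion A) ≃* cyclotome A where
  toFun := map (CommGroup.torsion A).subtype
  invFun ζ := ⟨fun n => ⟨(ζ : ℕ+ → A) n, apply_mem_torsion ζ n⟩,
    ⟨fun n => Subtype.ext (pow_eq_one ζ n), fun n m => Subtype.ext (pow_apply_mul ζ n m)⟩⟩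
  left_inv _ := Subtype.ext (funext fun _ => Subtype.ext rfl)
  right_inv _ := Subtype.ext (funext fun _ => rfl)
  map_mul' := map_mul _

/-- Components of `torsionEquiv`. [cite: LANA2026Report, §6.1 p.31] -/
@[simp] theorem torsionEquiv_apply_coe (ζ : cyclotome (CommGroup.torsion A)) (n : ℕ+) :
    ((torsionEquiv ζ : cyclotome A) : ℕ+ → A) n = (ζ : ℕ+ → CommGroup.torsion A) n := rfl

end Literature.AnabelianGeometry.EtaleTheta.cyclotome

namespace Literature.AnabelianGeometry.AbsoluteAnabelian

universe u

/-! ### `μ_Ẑ(G_k) ≅ Ẑ(1)` from torsion reciprocity data -/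

namespace TorsionReciprocityData

variable {k : Type u} [Field k] [CharZero k] (D : TorsionReciprocityData k)

/-- **`μ_Ẑ(G_k) ≃* Ẑ(1) = Λ(k̄ˣ)`** given torsion reciprocity data `D`: apply `Λ(−)` to
`D.equiv : μ_{ℚ/ℤ}(G_k) ≃ (k̄ˣ)_tors` and identify `Λ((k̄ˣ)_tors) = Λ(k̄ˣ)`. CONSTRUCTED.
[cite: MochizukiAbsTopIII2015, Cor 1.10 (i) p.42] -/
def muZhatEquiv :
    muZhat (Field.absoluteGaloisGroup k) ≃* EtaleTheta.cyclotome (AlgebraicClosure k)ˣ :=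
  (EtaleTheta.cyclotome.isoMap (AddEquiv.toMultiplicativeLeft D.equiv)).trans
    EtaleTheta.cyclotome.torsionEquiv

/-- Components of `D.muZhatEquiv`: the `n`-th root of unity is `D.equiv` of the `n`-th component.
[cite: MochizukiAbsTopIII2015, Cor 1.10 (i) p.42] -/
theorem muZhatEquiv_apply_coe (ζ : muZhat (Field.absoluteGaloisGroup k)) (n : ℕ+) :
    ((D.muZhatEquiv ζ : EtaleTheta.cyclotome (AlgebraicClosure k)ˣ) : ℕ+ → (AlgebraicClosure k)ˣ) n =
      ((Additive.toMul (D.equiv (Multiplicative.toAdd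
        ((ζ : ℕ+ → Multiplicative (muQZ (Field.absoluteGaloisGroup k))) n))) :
          CommGroup.torsion (AlgebraicClosure k)ˣ) : (AlgebraicClosure k)ˣ) := rfl

/-- **`G_k`-equivariance of `μ_Ẑ(G_k) ≃* Ẑ(1)`**: the conjugation action on the group-theoretic
cyclotome corresponds to the Galois action on roots of unity ([AbsAnab] Prop. 1.2.1 (vi)
«Galois-equivariant»; [AbsTopIII] Cor. 1.10 (i)(a)). [cite: MochizukiAbsTopIII2015, Cor 1.10 (i) p.42] -/
theorem muZhatEquiv_smul_coe (σ : Field.absoluteGaloisGroup k)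
    (ζ : muZhat (Field.absoluteGaloisGroup k)) (n : ℕ+) :
    ((((D.muZhatEquiv (σ • ζ) : EtaleTheta.cyclotome (AlgebraicClosure k)ˣ) :
        ℕ+ → (AlgebraicClosure k)ˣ) n : (AlgebraicClosure k)ˣ) : AlgebraicClosure k) =
      σ • ((((D.muZhatEquiv ζ : EtaleTheta.cyclotome (AlgebraicClosure k)ˣ) :
        ℕ+ → (AlgebraicClosure k)ˣ) n : (AlgebraicClosure k)ˣ) : AlgebraicClosure k) := by
  rw [muZhatEquiv_apply_coe, muZhatEquiv_apply_coe, muZhat.coe_smul_apply, muQZ.toAdd_smul]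
  exact D.equiv_smul σ _

end TorsionReciprocityData

/-- **«`μ_Ẑ(G_k) ≅ Ẑ(1)`», unconditional**: for every non-archimedean local field `k` of
characteristic `0` there is a `G_k`-equivariant isomorphism of the group-theoretic cyclotome
`μ_Ẑ(G_k) = Hom(ℚ/ℤ, μ_{ℚ/ℤ}(G_k))` with `Ẑ(1) = Λ(k̄ˣ) = lim_n μ_n(k̄)` (local class field theory:
`nonempty_torsionReciprocityData`). [cite: MochizukiAbsTopIII2015, Cor 1.10 (i) p.42] -/
theorem exists_muZhat_mulEquiv_cyclotome_units (k : Type u) [Field k] [CharZero k] [ValuativeRel k]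
    [TopologicalSpace k] [IsNonarchimedeanLocalField k] :
    ∃ e : muZhat (Field.absoluteGaloisGroup k) ≃* EtaleTheta.cyclotome (AlgebraicClosure k)ˣ,
      ∀ (σ : Field.absoluteGaloisGroup k) (ζ : muZhat (Field.absoluteGaloisGroup k)) (n : ℕ+),
        ((((e (σ • ζ) : EtaleTheta.cyclotome (AlgebraicClosure k)ˣ) : ℕ+ → (AlgebraicClosure k)ˣ) n :
            (AlgebraicClosure k)ˣ) : AlgebraicClosure k) =
          σ • ((((e ζ : EtaleTheta.cyclotome (AlgebraicClosure k)ˣ) : ℕ+ → (AlgebraicClosure k)ˣ) n :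
            (AlgebraicClosure k)ˣ) : AlgebraicClosure k) := by
  obtain ⟨D⟩ := nonempty_torsionReciprocityData k
  exact ⟨D.muZhatEquiv, D.muZhatEquiv_smul_coe⟩

/-- The same for the binder `IsMLF k` of the [AbsTopIII] typings (`nonempty_torsionReciprocityData_of_isMLF`).
[cite: MochizukiAbsTopIII2015, Cor 1.10 (i) p.42] -/
theorem exists_muZhat_mulEquiv_cyclotome_units_of_isMLF (k : Type u) [Field k] [CharZero k]
    (hk : IsMLF k) :
    ∃ e : muZhat (Field.absoluteGaloisGroup k) ≃* EtaleTheta.cyclotome (AlgebraicClosure k)ˣ,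
      ∀ (σ : Field.absoluteGaloisGroup k) (ζ : muZhat (Field.absoluteGaloisGroup k)) (n : ℕ+),
        ((((e (σ • ζ) : EtaleTheta.cyclotome (AlgebraicClosure k)ˣ) : ℕ+ → (AlgebraicClosure k)ˣ) n :
            (AlgebraicClosure k)ˣ) : AlgebraicClosure k) =
          σ • ((((e ζ : EtaleTheta.cyclotome (AlgebraicClosure k)ˣ) : ℕ+ → (AlgebraicClosure k)ˣ) n :
            (AlgebraicClosure k)ˣ) : AlgebraicClosure k) := by
  obtain ⟨D⟩ := nonempty_torsionReciprocityData_of_isMLF k hk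
  exact ⟨D.muZhatEquiv, D.muZhatEquiv_smul_coe⟩

/-! ### Rmk. 3.2.1 for the model pair, with the group-theoretic `μ_Ẑ(G_k)` as target -/

/-- The standard model closure datum `(k, AlgebraicClosure k)` of a non-archimedean local field of
characteristic `0` ([AbsTopIII] Def. 3.1 (i) «an algebraic closure `k̄`»).
[cite: MochizukiAbsTopIII2015, Definition 3.1 (i) p.66] -/
def MLFClosure.std (k : Type u) [Field k] [CharZero k] [ValuativeRel k] [TopologicalSpace k]
    [IsNonarchimedeanLocalField k] : MLFClosure.{u} :=
  { k := k, K := AlgebraicClosure k }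

/-- **Rmk. 3.2.1 «the natural isomorphism `μ_Ẑ(M_TM) ⥲ μ_Ẑ(G)`» for the model pair
`(G_k ↷ 𝒪_k̄^⊳)` with the GROUP-THEORETIC `μ_Ẑ(G_k)` of Cor. 1.10 (i)(a)** (given reciprocity data
`D`): `Λ((𝒪_k̄^⊳)ˣ) ⥲ Λ(k̄ˣ)` (abc-iut-L4-t2's `MLFClosure.cyclotomeUnitsEquiv`) followed by
`Λ(k̄ˣ) ⥲ μ_Ẑ(G_k)` (`D.muZhatEquiv.symm`). CONSTRUCTED. [cite: MochizukiAbsTopIII2015, Remark 3.2.1 p.73] -/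
def TorsionReciprocityData.cyclotomeNonzeroIntegersEquivMuZhat {k : Type u} [Field k] [CharZero k]
    [ValuativeRel k] [TopologicalSpace k] [IsNonarchimedeanLocalField k] (D : TorsionReciprocityData k) :
    cyclotome (nonzeroIntegers k (AlgebraicClosure k)) ≃* muZhat (Field.absoluteGaloisGroup k) :=
  (MLFClosure.std k).cyclotomeUnitsEquiv.trans D.muZhatEquiv.symm

/-- Under `D.cyclotomeNonzeroIntegersEquivMuZhat` followed by `D.muZhatEquiv : μ_Ẑ(G_k) ⥲ Λ(k̄ˣ)` a
compatible system of roots of unity in `𝒪_k̄^⊳` goes to ITSELF read in `k̄ˣ` (abc-iut-L4-t2's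
`cyclotomeUnitsEquiv`, components `coe_cyclotomeUnitsHom_apply`). [cite: MochizukiAbsTopIII2015, Remark 3.2.1 p.73] -/
theorem TorsionReciprocityData.muZhatEquiv_cyclotomeNonzeroIntegersEquivMuZhat {k : Type u} [Field k]
    [CharZero k] [ValuativeRel k] [TopologicalSpace k] [IsNonarchimedeanLocalField k]
    (D : TorsionReciprocityData k) (ζ : cyclotome (nonzeroIntegers k (AlgebraicClosure k))) :
    D.muZhatEquiv (D.cyclotomeNonzeroIntegersEquivMuZhat ζ) = (MLFClosure.std k).cyclotomeUnitsEquiv ζ :=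
  D.muZhatEquiv.apply_symm_apply _

/-- **Rmk. 3.2.1 for the model, unconditional existence form**: for every non-archimedean local field
`k` of characteristic `0` there are a `G_k`-equivariant identification `ι : μ_Ẑ(G_k) ⥲ Ẑ(1) = Λ(k̄ˣ)`
(local class field theory) and an isomorphism `e : μ_Ẑ(𝒪_k̄^⊳) = Λ((𝒪_k̄^⊳)ˣ) ⥲ μ_Ẑ(G_k)` such that
`ι ∘ e` is the tautological `Λ((𝒪_k̄^⊳)ˣ) ⥲ Λ(k̄ˣ)`. [cite: MochizukiAbsTopIII2015, Remark 3.2.1 p.73] -/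
theorem exists_cyclotome_nonzeroIntegers_mulEquiv_muZhat (k : Type u) [Field k] [CharZero k]
    [ValuativeRel k] [TopologicalSpace k] [IsNonarchimedeanLocalField k] :
    ∃ (ι : muZhat (Field.absoluteGaloisGroup k) ≃* EtaleTheta.cyclotome (AlgebraicClosure k)ˣ)
      (e : cyclotome (nonzeroIntegers k (AlgebraicClosure k)) ≃* muZhat (Field.absoluteGaloisGroup k)),
      (∀ (σ : Field.absoluteGaloisGroup k) (ζ : muZhat (Field.absoluteGaloisGroup k)) (n : ℕ+),
        ((((ι (σ • ζ) : EtaleTheta.cyclotome (AlgebraicClosure k)ˣ) : ℕ+ → (AlgebraicClosure k)ˣ) n :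
            (AlgebraicClosure k)ˣ) : AlgebraicClosure k) =
          σ • ((((ι ζ : EtaleTheta.cyclotome (AlgebraicClosure k)ˣ) : ℕ+ → (AlgebraicClosure k)ˣ) n :
            (AlgebraicClosure k)ˣ) : AlgebraicClosure k)) ∧
      ∀ ζ, ι (e ζ) = (MLFClosure.std k).cyclotomeUnitsEquiv ζ := by
  obtain ⟨D⟩ := nonempty_torsionReciprocityData k
  exact ⟨D.muZhatEquiv, D.cyclotomeNonzeroIntegersEquivMuZhat, D.muZhatEquiv_smul_coe,
    D.muZhatEquiv_cyclotomeNonzeroIntegersEquivMuZhat⟩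

end Literature.AnabelianGeometry.AbsoluteAnabelian

end
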